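import Summits.CriticalPhenomena.SAWScalingLimit.Theorems.SAWLeftRightFKGFKGToTraversalBoundRWCollarOfKilled2
import Summits.CriticalPhenomena.SAWScalingLimit.Theorems.SAWLeftRightFKGFKGToTraversalBoundSlitPresentation
import Literature.Probability.LatticeModels.KCFrozenBoundaryConnected
import Literature.Probability.LatticeModels.KCPrimitiveComponent
import HarnessLib

/-!
# The free component of the far tip (witness unit U0 of `stub_necklaceWitnessFarU`)

Crux `SAWLeftRightFKG.FKGToTraversalBound` (stmt-CriticalPhenomena-1878), line `slit-necklace`, registered stub
`free_carrier`.

`C : c → c` is a closed lattice walk presenting the carrier `Ω = dom C δ = {wind(C) ≠ 0}`,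
`Λ = meshDomain Ω δ` its lattice domain, `K` a finite set of sites ATTACHED to the trace of `C` (every `k ∈ K`
is joined to a vertex of `C` through sites of `K ∪ C.support`), `t ∉ K` a site with an `Ω_δ`-edge to a site off
`K`.  The FREE COMPONENT `F` of `t` is the set of sites joined to `t` by walks of `Ω_δ = discreteDomainGraph Ω δ`
avoiding `K`.  `free_carrier` proves: `F` is finite (it lies in `Λ`), `t ∈ F`, `F ⊆ Λ`, `F` is `4`-connected, the
complement of `F` is `4`-connected, the lattice neighbours of `F` outside `F` are sites of `K` or vertices of `C`
(contact classification), and lattice-adjacent sites of `F` are `Ω_δ`-adjacent (FACT A).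

Proof (all at mesh `1`, transported by `CornerLoc.discreteDomainGraph_dom` / `CornerLoc.meshDomain_dom`):
* FACT A for `Λ`: two lattice-adjacent sites of `Λ` are off the trace (`notMem_support_of_mem_meshVertices`), so
  the unit segment between them lies in `Ω` (`ExcursionDomination.meshGraph_adj_of_adj`) and they are
  `Ω_1`-adjacent; hence `F` is closed under lattice adjacency inside `Λ ∖ K`, which gives the contact
  classification (a neighbour off `Λ` and off the trace would pull its `Λ`-neighbour off `Λ`,
  `KilledReduction.notMem_meshDomain_north`) and FACT A;
* complement: `Λ ∖ K` is hole-free (`HoleFree`) — off `Λ` one escapes by `KilledReduction.holeFree_meshDomain_dom_one`,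
  from `K ∩ Λ` one first follows the attachment walk (its sites are in `K` or on the trace, hence off `Λ ∖ K`) to
  the trace, which is off `Λ`; `F ⊆ Λ ∖ K` is closed under adjacency inside `Λ ∖ K`, so `F` is hole-free
  (`HoleFree.of_adjClosed`), and the complement of a finite hole-free set is preconnected
  (`induce_compl_preconnected_of_holeFree`).

Everything is folklore lattice topology; no named fact is used.
-/

noncomputable section

open Set SimpleGraph
open Literature.Probability.LatticeModels
open Summit.CriticalPhenomena.SAWScalingLimit.Theorems.FKGToTraversalBound.Negative (dom)

namespace Summit.CriticalPhenomena.SAWScalingLimit.Theorems.FKGToTraversalBound.SlitNecklace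

open ExcursionDomination (notMem_support_of_mem_meshVertices)
open ExcursionDomination.KilledReduction
  (holeFree_meshDomain_dom_one notMem_meshDomain_north notMem_meshDomain_of_mem_support)

/-! ### Lattice facts about `Λ = meshDomain (dom C 1) 1` -/

/-- **FACT A.** Two lattice-adjacent sites of `Λ = meshDomain (dom C 1) 1` are adjacent in `Ω_1`: both are off
the trace of `C`, so the unit segment between them lies in `dom C 1`. [folklore] -/
theorem free_adj_of_mem_meshDomain {c : Site 2} (C : (zdGraph 2).Walk c c) {x y : Site 2}
    (hxy : (zdGraph 2).Adj x y) (hx : x ∈ meshDomain (dom C 1) 1) (hy : y ∈ meshDomain (dom C 1) 1) :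
    (discreteDomainGraph (dom C 1) 1).Adj x y :=
  discreteDomainGraph_adj_iff.2
    ⟨ExcursionDomination.meshGraph_adj_of_adj C hxy (meshDomain_subset_meshVertices _ _ hx)
      (notMem_support_of_mem_meshVertices C 1 (meshDomain_subset_meshVertices _ _ hy)), hx, hy⟩

/-- The start of a walk of `Ω_δ` ending in the lattice domain lies in the lattice domain. [folklore] -/
theorem free_mem_meshDomain_of_walk {Ω : Set ℂ} {δ : ℝ} {x t : Site 2}
    (q : (discreteDomainGraph Ω δ).Walk x t) (ht : t ∈ meshDomain Ω δ) : x ∈ meshDomain Ω δ := by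
  cases q with
  | nil => exact ht
  | cons h _ => exact (discreteDomainGraph_adj_iff.1 h).2.1

/-- **A lattice neighbour, off `Λ`, of a site of `Λ` is a vertex of `C`** (`notMem_meshDomain_north` read
contrapositively: both sites are off the trace otherwise, and then the one off `Λ` pulls the other off `Λ`).
[folklore] -/
theorem free_mem_support_of_adj_notMem {c : Site 2} (C : (zdGraph 2).Walk c c) {x y : Site 2}
    (hxy : (zdGraph 2).Adj x y) (hx : x ∈ meshDomain (dom C 1) 1) (hy : y ∉ meshDomain (dom C 1) 1) :
    y ∈ C.support := by
  by_contra hyC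
  have hxC : x ∉ C.support :=
    notMem_support_of_mem_meshVertices C 1 (meshDomain_subset_meshVertices _ _ hx)
  exact notMem_meshDomain_north C hxy.symm hy hyC hxC hx

/-- **`Λ ∖ K` is hole-free** when `K` is attached to the trace of `C`: off `Λ` one escapes by hole-freeness of
`Λ`; from a site of `K ∩ Λ` one follows the attachment walk (sites of `K` or of the trace, all off `Λ ∖ K`) to
the trace, which is off `Λ`. [folklore] -/
theorem free_holeFree_sdiff {c : Site 2} (C : (zdGraph 2).Walk c c) (K : Finset (Site 2))
    (hK : ∀ k ∈ K, ∃ (q : Site 2) (p : (zdGraph 2).Walk k q), q ∈ C.support ∧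
      ∀ x ∈ p.support, x ∈ K ∨ x ∈ C.support)
    (hΛ : (meshDomain (dom C 1) 1).Finite) :
    HoleFree (↑(hΛ.toFinset \ K) : Set (Site 2)) := by
  have hsub : (↑(hΛ.toFinset \ K) : Set (Site 2)) ⊆ meshDomain (dom C 1) 1 := fun z hz => by
    rw [Finset.coe_sdiff, Set.Finite.coe_toFinset] at hz
    exact hz.1
  intro g hg M
  -- escape from a site off `Λ`
  have esc : ∀ w : Site 2, w ∉ meshDomain (dom C 1) 1 →
      ∃ g' : Site 2, M ≤ g' 1 ∧ Relation.ReflTransGen (FaceStep (↑(hΛ.toFinset \ K) : Set (Site 2))) w g' := by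
    intro w hw
    obtain ⟨g', hg', hch⟩ := holeFree_meshDomain_dom_one C w hw M
    exact ⟨g', hg', reflTransGen_faceStep_mono hsub hch⟩
  by_cases hgΛ : g ∈ meshDomain (dom C 1) 1
  · -- then `g ∈ K`: follow the attachment walk to the trace
    have hgK : g ∈ K := by
      by_contra hgK
      exact hg (by rw [Finset.coe_sdiff, Set.Finite.coe_toFinset]; exact ⟨hgΛ, hgK⟩)
    obtain ⟨q, p, hqC, hp⟩ := hK g hgK
    have hpL : ∀ z ∈ p.support, z ∉ (↑(hΛ.toFinset \ K) : Set (Site 2)) := by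
      intro z hz hzL
      rw [Finset.coe_sdiff, Set.Finite.coe_toFinset] at hzL
      rcases hp z hz with h | h
      · exact hzL.2 h
      · exact notMem_meshDomain_of_mem_support C h hzL.1
    obtain ⟨g', hg', hch⟩ := esc q (notMem_meshDomain_of_mem_support C hqC)
    exact ⟨g', hg', (reflTransGen_faceStep_of_walk p hpL).trans hch⟩
  · exact esc g hgΛ

/-- A walk of the subgraph of `ℤ²` induced on the complement of `S` is a lattice walk off `S`. [folklore] -/
theorem free_exists_walk_of_induce_compl {S : Set (Site 2)} {x y : Site 2} (hx : x ∈ Sᶜ) (hy : y ∈ Sᶜ)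
    (p : ((zdGraph 2).induce Sᶜ).Walk ⟨x, hx⟩ ⟨y, hy⟩) :
    ∃ q : (zdGraph 2).Walk x y, ∀ z ∈ q.support, z ∉ S := by
  refine ⟨(p.map (Embedding.induce Sᶜ).toHom).copy rfl rfl, fun z hz => ?_⟩
  rw [Walk.support_copy, Walk.support_map] at hz
  obtain ⟨w, -, rfl⟩ := List.mem_map.1 hz
  exact w.2

/-! ### The free component at mesh `1` -/

/-- **The free component of `t` at mesh `1`**: the set `F` of sites joined to `t` by `Ω_1`-walks avoiding the
attached set `K` is finite, contains `t`, lies in `Λ`, is `4`-connected with `4`-connected complement, its outside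
lattice neighbours are sites of `K` or vertices of `C`, and lattice-adjacent sites of `F` are `Ω_1`-adjacent.
[folklore] -/
theorem free_carrier_one {c : Site 2} (C : (zdGraph 2).Walk c c) (K : Finset (Site 2)) (t : Site 2)
    (htK : t ∉ K)
    (hK : ∀ k ∈ K, ∃ (q : Site 2) (p : (zdGraph 2).Walk k q), q ∈ C.support ∧
      ∀ x ∈ p.support, x ∈ K ∨ x ∈ C.support)
    (hty : ∃ y, (discreteDomainGraph (dom C 1) 1).Adj t y ∧ y ∉ K) :
    ∃ F : Finset (Site 2),
      (∀ x, x ∈ F ↔ ∃ q : (discreteDomainGraph (dom C 1) 1).Walk x t, ∀ v ∈ q.support, v ∉ K) ∧ t ∈ F ∧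
      (∀ x ∈ F, x ∈ meshDomain (dom C 1) 1) ∧
      (∀ x ∈ F, ∀ y ∈ F, ∃ p : (zdGraph 2).Walk x y, ∀ z ∈ p.support, z ∈ F) ∧
      (∀ x y : Site 2, x ∉ F → y ∉ F → ∃ p : (zdGraph 2).Walk x y, ∀ z ∈ p.support, z ∉ F) ∧
      (∀ x ∈ F, ∀ y : Site 2, y ∉ F → (zdGraph 2).Adj x y → y ∈ K ∨ y ∈ C.support) ∧
      (∀ x ∈ F, ∀ y ∈ F, (zdGraph 2).Adj x y → (discreteDomainGraph (dom C 1) 1).Adj x y) := by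
  classical
  -- the free set, abstractly
  obtain ⟨Fs, hFs⟩ : ∃ Fs : Set (Site 2), ∀ x, x ∈ Fs ↔
      ∃ q : (discreteDomainGraph (dom C 1) 1).Walk x t, ∀ v ∈ q.support, v ∉ K :=
    ⟨{x | ∃ q : (discreteDomainGraph (dom C 1) 1).Walk x t, ∀ v ∈ q.support, v ∉ K}, fun _ => Iff.rfl⟩
  have hGle : discreteDomainGraph (dom C 1) 1 ≤ zdGraph 2 :=
    (discreteDomainGraph_le_meshGraph _ _).trans (meshGraph_le_zdGraph _ _)
  obtain ⟨y₀, hty₀, -⟩ := hty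
  have htΛ : t ∈ meshDomain (dom C 1) 1 := (discreteDomainGraph_adj_iff.1 hty₀).2.1
  have hFsΛ : ∀ x ∈ Fs, x ∈ meshDomain (dom C 1) 1 := fun x hx => by
    obtain ⟨q, -⟩ := (hFs x).1 hx
    exact free_mem_meshDomain_of_walk q htΛ
  have hFsK : ∀ x ∈ Fs, x ∉ K := fun x hx => by
    obtain ⟨q, hq⟩ := (hFs x).1 hx
    exact hq x q.start_mem_support
  have htFs : t ∈ Fs := (hFs t).2 ⟨Walk.nil, fun v hv => by
    rw [Walk.support_nil, List.mem_singleton] at hv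
    exact hv ▸ htK⟩
  -- every vertex of a witnessing walk is free
  have hsupp : ∀ (x : Site 2) (q : (discreteDomainGraph (dom C 1) 1).Walk x t), (∀ v ∈ q.support, v ∉ K) →
      ∀ v ∈ q.support, v ∈ Fs := fun x q hq v hv =>
    (hFs v).2 ⟨q.dropUntil v hv, fun w hw => hq w (q.support_dropUntil_subset_support hv hw)⟩
  -- a neighbour in `Ω_1` off `K` of a free site is free
  have hext : ∀ x ∈ Fs, ∀ y : Site 2, (discreteDomainGraph (dom C 1) 1).Adj x y → y ∉ K → y ∈ Fs := by
    intro x hx y hxy hyK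
    obtain ⟨q, hq⟩ := (hFs x).1 hx
    refine (hFs y).2 ⟨Walk.cons hxy.symm q, fun v hv => ?_⟩
    rw [Walk.support_cons, List.mem_cons] at hv
    rcases hv with rfl | hv
    exacts [hyK, hq v hv]
  -- finiteness
  have hbdd : Bornology.IsBounded (dom C 1) := LeftRightFKG.CornerLoc.isBounded_dom C 1
  have hΛfin : (meshDomain (dom C 1) 1).Finite := meshDomain_finite hbdd one_pos
  have hFfin : Fs.Finite := hΛfin.subset fun x hx => hFsΛ x hx
  have hmem : ∀ x, x ∈ hFfin.toFinset ↔ x ∈ Fs := fun x => hFfin.mem_toFinset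
  refine ⟨hFfin.toFinset, fun x => (hmem x).trans (hFs x), (hmem t).2 htFs,
    fun x hx => hFsΛ x ((hmem x).1 hx), ?_, ?_, ?_, ?_⟩
  · -- `F` is `4`-connected: concatenate the two witnessing walks through `t`
    intro x hx y hy
    obtain ⟨qx, hqx⟩ := (hFs x).1 ((hmem x).1 hx)
    obtain ⟨qy, hqy⟩ := (hFs y).1 ((hmem y).1 hy)
    refine ⟨(qx.append qy.reverse).mapLe hGle, fun z hz => (hmem z).2 ?_⟩
    rw [Walk.support_mapLe_eq_support, Walk.mem_support_append_iff, Walk.support_reverse,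
      List.mem_reverse] at hz
    rcases hz with hz | hz
    · exact hsupp x qx hqx z hz
    · exact hsupp y qy hqy z hz
  · -- the complement is `4`-connected: `F` is hole-free
    intro x y hx hy
    have hFL : hFfin.toFinset ⊆ hΛfin.toFinset \ K := fun z hz => by
      have hz' := (hmem z).1 hz
      exact Finset.mem_sdiff.2 ⟨hΛfin.mem_toFinset.2 (hFsΛ z hz'), hFsK z hz'⟩
    have hclosed : ∀ a ∈ hFfin.toFinset, ∀ b ∈ hΛfin.toFinset \ K, (zdGraph 2).Adj a b →
        b ∈ hFfin.toFinset := by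
      intro a ha b hb hab
      have ha' := (hmem a).1 ha
      obtain ⟨hbΛ, hbK⟩ := Finset.mem_sdiff.1 hb
      exact (hmem b).2 (hext a ha' b
        (free_adj_of_mem_meshDomain C hab (hFsΛ a ha') (hΛfin.mem_toFinset.1 hbΛ)) hbK)
    have hFhf : HoleFree (↑hFfin.toFinset : Set (Site 2)) :=
      (free_holeFree_sdiff C K hK hΛfin).of_adjClosed hFL hclosed
    have hx' : x ∈ (↑hFfin.toFinset : Set (Site 2))ᶜ := fun h => hx (Finset.mem_coe.1 h)
    have hy' : y ∈ (↑hFfin.toFinset : Set (Site 2))ᶜ := fun h => hy (Finset.mem_coe.1 h)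
    obtain ⟨p⟩ := induce_compl_preconnected_of_holeFree hFhf ⟨x, hx'⟩ ⟨y, hy'⟩
    obtain ⟨q, hq⟩ := free_exists_walk_of_induce_compl hx' hy' p
    exact ⟨q, fun z hz h => hq z hz (Finset.mem_coe.2 h)⟩
  · -- contacts: an outside lattice neighbour of a free site is in `K` or on the trace
    intro x hx y hy hxy
    have hxF := (hmem x).1 hx
    by_contra h
    push Not at h
    have hxΛ : x ∈ meshDomain (dom C 1) 1 := hFsΛ x hxF
    have hyΛ : y ∈ meshDomain (dom C 1) 1 := by
      by_contra hyΛ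
      exact h.2 (free_mem_support_of_adj_notMem C hxy hxΛ hyΛ)
    exact hy ((hmem y).2 (hext x hxF y (free_adj_of_mem_meshDomain C hxy hxΛ hyΛ) h.1))
  · -- FACT A
    intro x hx y hy hxy
    exact free_adj_of_mem_meshDomain C hxy (hFsΛ x ((hmem x).1 hx)) (hFsΛ y ((hmem y).1 hy))

/-! ### The registered stub -/

/-- **Witness unit U0 — the free component of the far tip.**  For a closed lattice walk `C` with carrier
`Ω = dom C δ`, a finite set `K` of sites attached to the trace of `C`, and a site `t ∉ K` with an `Ω_δ`-edge to a
site off `K`, the set `F` of sites joined to `t` by `Ω_δ`-walks avoiding `K` is a finite set containing `t`, inside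
the lattice domain `meshDomain Ω δ`, `4`-connected with `4`-connected complement, whose outside lattice neighbours
are sites of `K` or vertices of `C`, and whose lattice-adjacent sites are `Ω_δ`-adjacent (FACT A).  Reduced to mesh
`1` by `CornerLoc.discreteDomainGraph_dom` and `CornerLoc.meshDomain_dom`. [folklore] -/
theorem free_carrier : ∀ (δ : ℝ) (c : Site 2) (C : (zdGraph 2).Walk c c) (K : Finset (Site 2)) (t : Site 2),
    0 < δ → t ∉ K → (∀ k ∈ K, ∃ (q : Site 2) (p : (zdGraph 2).Walk k q), q ∈ C.support ∧
      ∀ x ∈ p.support, x ∈ K ∨ x ∈ C.support) → (∃ y, (discreteDomainGraph (dom C δ) δ).Adj t y ∧ y ∉ K) →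
    ∃ F : Finset (Site 2), (∀ x, x ∈ F ↔ ∃ q : (discreteDomainGraph (dom C δ) δ).Walk x t,
      ∀ v ∈ q.support, v ∉ K) ∧ t ∈ F ∧ (∀ x ∈ F, x ∈ meshDomain (dom C δ) δ) ∧
      (∀ x ∈ F, ∀ y ∈ F, ∃ p : (zdGraph 2).Walk x y, ∀ z ∈ p.support, z ∈ F) ∧
      (∀ x y : Site 2, x ∉ F → y ∉ F → ∃ p : (zdGraph 2).Walk x y, ∀ z ∈ p.support, z ∉ F) ∧
      (∀ x ∈ F, ∀ y : Site 2, y ∉ F → (zdGraph 2).Adj x y → y ∈ K ∨ y ∈ C.support) ∧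
      (∀ x ∈ F, ∀ y ∈ F, (zdGraph 2).Adj x y → (discreteDomainGraph (dom C δ) δ).Adj x y) := by
  intro δ c C K t hδ htK hK hty
  have eG : discreteDomainGraph (dom C δ) δ = discreteDomainGraph (dom C 1) 1 :=
    LeftRightFKG.CornerLoc.discreteDomainGraph_dom C hδ.ne'
  have eΛ : meshDomain (dom C δ) δ = meshDomain (dom C 1) 1 :=
    LeftRightFKG.CornerLoc.meshDomain_dom C hδ.ne'
  rw [eG] at hty
  rw [eG, eΛ]
  exact free_carrier_one C K t htK hK hty

end Summit.CriticalPhenomena.SAWScalingLimit.Theorems.FKGToTraversalBound.SlitNecklace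

end
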